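import Mathlib
import HarnessLib
import Summits.HubbardSuperconductivity.HubbardSuperconductivity.Theorems.KLProgrammeKLRegimeEngineScaleZeroGridTransfer
import Summits.HubbardSuperconductivity.HubbardSuperconductivity.Theorems.KLProgrammeKLRegimeSplitTwoLegIncrementRep

/-!
# Route `KLProgramme` — ENGINE child gen 8 (stmt-HubbardSuperconductivity-20437 `KLRegimeEngineV17F2`), class #7 in GRID currency ((Y′)-GRID, plan g19
# (R59o)/(R59ac)), deliverable W3 «plain-leg m = 2 read-out pass»: the GRID INCREMENT IDENTITY at a fixed frame — the per-scale representation whose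
# three pieces W3's analytic half bounds (cell gate-hubbard-kl, seat hubbard-kl-k3c2-p3 g7; grid twin of r2d-p1's `…SplitTwoLegIncrementRep` §2)

With `N = 4M`, `S := hubbardGridSub L M β N` (the grid substitution), `Ṽ := V_N + 𝒩_{K,N}` and `W_j[K] := effAction (Sᵀ C^K_{>Λ_j} S) Ṽ` (the grid action whose
image `map S (W_j[K] − 𝒩_{K,N}) = 𝒱⁽ʲ⁾[K] − 𝒩_K`, `…SplitTwoLegGridScale`; the object of the class-#7 atom `TwoLegGridMomentsAt`, p557865):

* `gridEffPartitionFn_eq_hubbardEffPartitionFnCT` — the grid partition function at `Λ` IS `Z^K_Λ` (`effPartitionFn_map` along `S`);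
* **`gridEffAction_succ_eq_effAction_slice`** — ONE SLICE ON THE GRID: `W_{j+1}[K] = effAction (Sᵀ C^K_{(Λ_{j+1},Λ_j]} S) (W_j[K])` whenever `Z^K_{Λ_j} ≠ 0`
  (`effAction_add`; grid twin of `klEffectiveAction_succ_eq_effAction_slice`); `gridEffAction_eq_effAction_slice` (any two scales);
* **`kernel_gridEffAction_succ_sub_eq`** — r2d-p1's `kernel_effAction_sub_split` on the grid, every degree `m`, every grid string `X`:
  `kernel_m (W_{j+1}[K] − W_j[K]) X = kernel_m (Δ_G W_j) X + kernel_m (e^{Δ_G}W_j − W_j − Δ_G W_j) X + kernel_m (effAction G W_j − e^{Δ_G}W_j) X`,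
  `G := Sᵀ C^K_{(Λ_{j+1},Λ_j]} S` — ONE line (tadpole of the grid slice propagator) · ≥ 2 self-lines · ≥ 2 vertices; the last two are bounded BY NAME in the
  tree (`sum_[wt_]norm_kernel_gaussConv_sub_le[_binomial_prescribed…]` minus its one-line term, `sum_[wt_]norm_kernel_effAction_sub_gaussConv_le[_graded_prescribed]_of_gramBounded`);
* `norm_kernel_gridEffAction_succ_sub_le` — the triangle inequality on the three pieces (the shape in which the `klScaleWt (j+1)`-weighted plain-pin masses
  `b j` of `…TwoLegGridMomentsTelescope.twoLegGridMomentsAt_of_wtIncrements` are assembled: `b = b_tad + b_self + b_tree`), and its weighted pinned-sum form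
  `sum_wt_norm_kernel_gridEffAction_succ_sub_le`.

Exact identities + one triangle inequality; no estimate, no definition; nothing about the model's sizes is asserted; nothing asserts superconductivity.
References: BGM 2006 §2.2 (2.12)–(2.14), §2.3 (2.17)–(2.23) [cite: BenfattoGiulianiMastropietro2006]; Salmhofer 1999 §2.5.1 (2.106), §4.3 (4.95) [cite: Salmhofer1999].
-/

noncomputable section

namespace Summit.HubbardSuperconductivity.HubbardSuperconductivity.Theorems.EngineV8

set_option linter.dupNamespace false -- summit = problem name (single-conjunct summit), D-0017

open Real Finset Literature.MathematicalPhysics.QuantumLattice Literature.Probability.LatticeModels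
open Literature.Probability.LatticeModels.BattleFederbush GrassmannAlgebra
open Summit.HubbardSuperconductivity.HubbardSuperconductivity.Theorems.KLRegimeSplit
open Summit.HubbardSuperconductivity.HubbardSuperconductivity.Theorems.KLProgrammeLegKernels

section Model

variable {L M : ℕ} [NeZero L] [NeZero M]


/-- **The grid partition function at scale `Λ` is the model's** `Z^K_Λ` (`β ≠ 0`):
`effPartitionFn (S_{4M}ᵀ C^K_{>Λ} S_{4M}) (V_{4M} + 𝒩_{K,4M}) = hubbardEffPartitionFnCT L M β U μ 0 K Λ` (`effPartitionFn_map` along the grid substitution). -/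
theorem gridEffPartitionFn_eq_hubbardEffPartitionFnCT {β : ℝ} (hβ : β ≠ 0) (U μ : ℝ) (K : TrigPolyC4v) (Λ : ℝ) :
    effPartitionFn ℂ ((hubbardGridSub L M β (2 * (2 * M))).transpose * hubbardCovAboveCT L M β μ 0 K Λ * hubbardGridSub L M β (2 * (2 * M)))
        (hubbardGridInteraction L (2 * (2 * M)) β U + hubbardGridCounterQuadratic L (2 * (2 * M)) β K) =
      hubbardEffPartitionFnCT L M β U μ 0 K Λ := by
  haveI : NeZero (2 * (2 * M) : ℕ) := ⟨by have := NeZero.ne M; omega⟩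
  have h := effPartitionFn_map (f := Matrix.toLin' (hubbardGridSub L M β (2 * (2 * M)))) (C' := hubbardCovAboveCT L M β μ 0 K Λ)
    (V := hubbardGridInteraction L (2 * (2 * M)) β U + hubbardGridCounterQuadratic L (2 * (2 * M)) β K)
  rw [LinearMap.toMatrix'_toLin', map_hubbardGridSub_gridInteractionCT hβ U K (by omega) (by omega)] at h
  rw [← h]
  rfl

/-- **ONE SLICE ON THE GRID AT A FIXED FRAME** (`β ≠ 0`, `Z^K_{Λ_j} ≠ 0`): `W_{j+1}[K] = effAction (S_{4M}ᵀ C^K_{(Λ_{j+1},Λ_j]} S_{4M}) (W_j[K])` — the grid twin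
of `klEffectiveAction_succ_eq_effAction_slice` (`effAction_add`; the intermediate grid partition function is `Z^K_{Λ_j}`). -/
theorem gridEffAction_succ_eq_effAction_slice {β : ℝ} (hβ : β ≠ 0) (U μ : ℝ) (K : TrigPolyC4v) (j : ℕ)
    (hZ : hubbardEffPartitionFnCT L M β U μ 0 K (klScale klE0 j) ≠ 0) :
    effAction ℂ ((hubbardGridSub L M β (2 * (2 * M))).transpose *
        hubbardCovAboveCT L M β μ 0 K (klScale klE0 (j + 1)) * hubbardGridSub L M β (2 * (2 * M)))
      (hubbardGridInteraction L (2 * (2 * M)) β U + hubbardGridCounterQuadratic L (2 * (2 * M)) β K) =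
      effAction ℂ ((hubbardGridSub L M β (2 * (2 * M))).transpose *
          hubbardCovSliceCT L M β μ 0 K (klScale klE0 (j + 1)) (klScale klE0 j) * hubbardGridSub L M β (2 * (2 * M)))
        (effAction ℂ ((hubbardGridSub L M β (2 * (2 * M))).transpose *
            hubbardCovAboveCT L M β μ 0 K (klScale klE0 j) * hubbardGridSub L M β (2 * (2 * M)))
          (hubbardGridInteraction L (2 * (2 * M)) β U + hubbardGridCounterQuadratic L (2 * (2 * M)) β K)) := by
  rw [hubbardCovAboveCT_eq_slice_add L M β μ 0 K (klScale klE0 (j + 1)) (klScale klE0 j), Matrix.mul_add, Matrix.add_mul]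
  refine effAction_add ℂ _ _ _ ?_
  rw [gridEffPartitionFn_eq_hubbardEffPartitionFnCT hβ]
  exact isUnit_iff_ne_zero.2 hZ

/-- **Any two scales on the grid** (`β ≠ 0`; `Λ_i` finer than `Λ_j` intended, `Z^K_{Λ_j} ≠ 0`): `W_i[K] = effAction (S_{4M}ᵀ C^K_{(Λ_i,Λ_j]} S_{4M}) (W_j[K])`. -/
theorem gridEffAction_eq_effAction_slice {β : ℝ} (hβ : β ≠ 0) (U μ : ℝ) (K : TrigPolyC4v) (i j : ℕ)
    (hZ : hubbardEffPartitionFnCT L M β U μ 0 K (klScale klE0 j) ≠ 0) :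
    effAction ℂ ((hubbardGridSub L M β (2 * (2 * M))).transpose *
        hubbardCovAboveCT L M β μ 0 K (klScale klE0 i) * hubbardGridSub L M β (2 * (2 * M)))
      (hubbardGridInteraction L (2 * (2 * M)) β U + hubbardGridCounterQuadratic L (2 * (2 * M)) β K) =
      effAction ℂ ((hubbardGridSub L M β (2 * (2 * M))).transpose *
          hubbardCovSliceCT L M β μ 0 K (klScale klE0 i) (klScale klE0 j) * hubbardGridSub L M β (2 * (2 * M)))
        (effAction ℂ ((hubbardGridSub L M β (2 * (2 * M))).transpose *
            hubbardCovAboveCT L M β μ 0 K (klScale klE0 j) * hubbardGridSub L M β (2 * (2 * M)))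
          (hubbardGridInteraction L (2 * (2 * M)) β U + hubbardGridCounterQuadratic L (2 * (2 * M)) β K)) := by
  rw [hubbardCovAboveCT_eq_slice_add L M β μ 0 K (klScale klE0 i) (klScale klE0 j), Matrix.mul_add, Matrix.add_mul]
  refine effAction_add ℂ _ _ _ ?_
  rw [gridEffPartitionFn_eq_hubbardEffPartitionFnCT hβ]
  exact isUnit_iff_ne_zero.2 hZ

/-- **THE GRID INCREMENT IDENTITY** (`β ≠ 0`, `Z^K_{Λ_j} ≠ 0`; any degree `m`, any grid string `X`): with `G := S_{4M}ᵀ C^K_{(Λ_{j+1},Λ_j]} S_{4M}` the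
grid slice covariance and `W_j := W_j[K]`,
`kernel_m (W_{j+1}[K] − W_j[K]) X = kernel_m (Δ_G W_j) X + kernel_m (e^{Δ_G}W_j − W_j − Δ_G W_j) X + kernel_m (effAction G W_j − e^{Δ_G}W_j) X`
— ONE line (tadpole) · ≥ 2 self-lines · ≥ 2 vertices (r2d-p1's `kernel_effAction_sub_split` on the grid). -/
theorem kernel_gridEffAction_succ_sub_eq {β : ℝ} (hβ : β ≠ 0) (U μ : ℝ) (K : TrigPolyC4v) (j : ℕ)
    (hZ : hubbardEffPartitionFnCT L M β U μ 0 K (klScale klE0 j) ≠ 0) (m : ℕ) (X : Fin m → GridLeg (GridPoint L (2 * (2 * M)))) :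
    kernel ℂ
        (effAction ℂ ((hubbardGridSub L M β (2 * (2 * M))).transpose *
            hubbardCovAboveCT L M β μ 0 K (klScale klE0 (j + 1)) * hubbardGridSub L M β (2 * (2 * M)))
          (hubbardGridInteraction L (2 * (2 * M)) β U + hubbardGridCounterQuadratic L (2 * (2 * M)) β K) -
        effAction ℂ ((hubbardGridSub L M β (2 * (2 * M))).transpose *
            hubbardCovAboveCT L M β μ 0 K (klScale klE0 j) * hubbardGridSub L M β (2 * (2 * M)))
          (hubbardGridInteraction L (2 * (2 * M)) β U + hubbardGridCounterQuadratic L (2 * (2 * M)) β K)) m X =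
      kernel ℂ (grassmannLaplacian ℂ
          ((hubbardGridSub L M β (2 * (2 * M))).transpose *
            hubbardCovSliceCT L M β μ 0 K (klScale klE0 (j + 1)) (klScale klE0 j) * hubbardGridSub L M β (2 * (2 * M)))
          (effAction ℂ ((hubbardGridSub L M β (2 * (2 * M))).transpose *
              hubbardCovAboveCT L M β μ 0 K (klScale klE0 j) * hubbardGridSub L M β (2 * (2 * M)))
            (hubbardGridInteraction L (2 * (2 * M)) β U + hubbardGridCounterQuadratic L (2 * (2 * M)) β K))) m X +
      kernel ℂ (gaussConv ℂ
            ((hubbardGridSub L M β (2 * (2 * M))).transpose *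
              hubbardCovSliceCT L M β μ 0 K (klScale klE0 (j + 1)) (klScale klE0 j) * hubbardGridSub L M β (2 * (2 * M)))
            (effAction ℂ ((hubbardGridSub L M β (2 * (2 * M))).transpose *
                hubbardCovAboveCT L M β μ 0 K (klScale klE0 j) * hubbardGridSub L M β (2 * (2 * M)))
              (hubbardGridInteraction L (2 * (2 * M)) β U + hubbardGridCounterQuadratic L (2 * (2 * M)) β K)) -
          effAction ℂ ((hubbardGridSub L M β (2 * (2 * M))).transpose *
              hubbardCovAboveCT L M β μ 0 K (klScale klE0 j) * hubbardGridSub L M β (2 * (2 * M)))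
            (hubbardGridInteraction L (2 * (2 * M)) β U + hubbardGridCounterQuadratic L (2 * (2 * M)) β K) -
          grassmannLaplacian ℂ
            ((hubbardGridSub L M β (2 * (2 * M))).transpose *
              hubbardCovSliceCT L M β μ 0 K (klScale klE0 (j + 1)) (klScale klE0 j) * hubbardGridSub L M β (2 * (2 * M)))
            (effAction ℂ ((hubbardGridSub L M β (2 * (2 * M))).transpose *
                hubbardCovAboveCT L M β μ 0 K (klScale klE0 j) * hubbardGridSub L M β (2 * (2 * M)))
              (hubbardGridInteraction L (2 * (2 * M)) β U + hubbardGridCounterQuadratic L (2 * (2 * M)) β K))) m X +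
      kernel ℂ (effAction ℂ
            ((hubbardGridSub L M β (2 * (2 * M))).transpose *
              hubbardCovSliceCT L M β μ 0 K (klScale klE0 (j + 1)) (klScale klE0 j) * hubbardGridSub L M β (2 * (2 * M)))
            (effAction ℂ ((hubbardGridSub L M β (2 * (2 * M))).transpose *
                hubbardCovAboveCT L M β μ 0 K (klScale klE0 j) * hubbardGridSub L M β (2 * (2 * M)))
              (hubbardGridInteraction L (2 * (2 * M)) β U + hubbardGridCounterQuadratic L (2 * (2 * M)) β K)) -
          gaussConv ℂ
            ((hubbardGridSub L M β (2 * (2 * M))).transpose *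
              hubbardCovSliceCT L M β μ 0 K (klScale klE0 (j + 1)) (klScale klE0 j) * hubbardGridSub L M β (2 * (2 * M)))
            (effAction ℂ ((hubbardGridSub L M β (2 * (2 * M))).transpose *
                hubbardCovAboveCT L M β μ 0 K (klScale klE0 j) * hubbardGridSub L M β (2 * (2 * M)))
              (hubbardGridInteraction L (2 * (2 * M)) β U + hubbardGridCounterQuadratic L (2 * (2 * M)) β K))) m X := by
  rw [kernel_sub', gridEffAction_succ_eq_effAction_slice hβ U μ K j hZ, kernel_effAction_sub_split]


/-- **THE THREE-PIECE TRIANGLE INEQUALITY** (`β ≠ 0`, `Z^K_{Λ_j} ≠ 0`): `‖kernel_m (W_{j+1}[K] − W_j[K]) X‖ ≤ ‖tadpole‖ + ‖≥ 2 self-lines‖ + ‖≥ 2 vertices‖`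
(the three kernels of `kernel_gridEffAction_succ_sub_eq`). -/
theorem norm_kernel_gridEffAction_succ_sub_le {β : ℝ} (hβ : β ≠ 0) (U μ : ℝ) (K : TrigPolyC4v) (j : ℕ)
    (hZ : hubbardEffPartitionFnCT L M β U μ 0 K (klScale klE0 j) ≠ 0) (m : ℕ) (X : Fin m → GridLeg (GridPoint L (2 * (2 * M)))) :
    ‖kernel ℂ
        (effAction ℂ ((hubbardGridSub L M β (2 * (2 * M))).transpose *
            hubbardCovAboveCT L M β μ 0 K (klScale klE0 (j + 1)) * hubbardGridSub L M β (2 * (2 * M)))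
          (hubbardGridInteraction L (2 * (2 * M)) β U + hubbardGridCounterQuadratic L (2 * (2 * M)) β K) -
        effAction ℂ ((hubbardGridSub L M β (2 * (2 * M))).transpose *
            hubbardCovAboveCT L M β μ 0 K (klScale klE0 j) * hubbardGridSub L M β (2 * (2 * M)))
          (hubbardGridInteraction L (2 * (2 * M)) β U + hubbardGridCounterQuadratic L (2 * (2 * M)) β K)) m X‖ ≤
      ‖kernel ℂ (grassmannLaplacian ℂ
          ((hubbardGridSub L M β (2 * (2 * M))).transpose *
            hubbardCovSliceCT L M β μ 0 K (klScale klE0 (j + 1)) (klScale klE0 j) * hubbardGridSub L M β (2 * (2 * M)))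
          (effAction ℂ ((hubbardGridSub L M β (2 * (2 * M))).transpose *
              hubbardCovAboveCT L M β μ 0 K (klScale klE0 j) * hubbardGridSub L M β (2 * (2 * M)))
            (hubbardGridInteraction L (2 * (2 * M)) β U + hubbardGridCounterQuadratic L (2 * (2 * M)) β K))) m X‖ +
      ‖kernel ℂ (gaussConv ℂ
            ((hubbardGridSub L M β (2 * (2 * M))).transpose *
              hubbardCovSliceCT L M β μ 0 K (klScale klE0 (j + 1)) (klScale klE0 j) * hubbardGridSub L M β (2 * (2 * M)))
            (effAction ℂ ((hubbardGridSub L M β (2 * (2 * M))).transpose *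
                hubbardCovAboveCT L M β μ 0 K (klScale klE0 j) * hubbardGridSub L M β (2 * (2 * M)))
              (hubbardGridInteraction L (2 * (2 * M)) β U + hubbardGridCounterQuadratic L (2 * (2 * M)) β K)) -
          effAction ℂ ((hubbardGridSub L M β (2 * (2 * M))).transpose *
              hubbardCovAboveCT L M β μ 0 K (klScale klE0 j) * hubbardGridSub L M β (2 * (2 * M)))
            (hubbardGridInteraction L (2 * (2 * M)) β U + hubbardGridCounterQuadratic L (2 * (2 * M)) β K) -
          grassmannLaplacian ℂ
            ((hubbardGridSub L M β (2 * (2 * M))).transpose *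
              hubbardCovSliceCT L M β μ 0 K (klScale klE0 (j + 1)) (klScale klE0 j) * hubbardGridSub L M β (2 * (2 * M)))
            (effAction ℂ ((hubbardGridSub L M β (2 * (2 * M))).transpose *
                hubbardCovAboveCT L M β μ 0 K (klScale klE0 j) * hubbardGridSub L M β (2 * (2 * M)))
              (hubbardGridInteraction L (2 * (2 * M)) β U + hubbardGridCounterQuadratic L (2 * (2 * M)) β K))) m X‖ +
      ‖kernel ℂ (effAction ℂ
            ((hubbardGridSub L M β (2 * (2 * M))).transpose *
              hubbardCovSliceCT L M β μ 0 K (klScale klE0 (j + 1)) (klScale klE0 j) * hubbardGridSub L M β (2 * (2 * M)))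
            (effAction ℂ ((hubbardGridSub L M β (2 * (2 * M))).transpose *
                hubbardCovAboveCT L M β μ 0 K (klScale klE0 j) * hubbardGridSub L M β (2 * (2 * M)))
              (hubbardGridInteraction L (2 * (2 * M)) β U + hubbardGridCounterQuadratic L (2 * (2 * M)) β K)) -
          gaussConv ℂ
            ((hubbardGridSub L M β (2 * (2 * M))).transpose *
              hubbardCovSliceCT L M β μ 0 K (klScale klE0 (j + 1)) (klScale klE0 j) * hubbardGridSub L M β (2 * (2 * M)))
            (effAction ℂ ((hubbardGridSub L M β (2 * (2 * M))).transpose *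
                hubbardCovAboveCT L M β μ 0 K (klScale klE0 j) * hubbardGridSub L M β (2 * (2 * M)))
              (hubbardGridInteraction L (2 * (2 * M)) β U + hubbardGridCounterQuadratic L (2 * (2 * M)) β K))) m X‖ := by
  rw [kernel_gridEffAction_succ_sub_eq hβ U μ K j hZ m X]
  exact norm_add₃_le

/-- **WEIGHTED PINNED-SUM FORM** (`β ≠ 0`, `Z^K_{Λ_j} ≠ 0`): for any finite family `P` of grid strings and any nonnegative string weight `ω`, if the `ω`-weighted
sums over `P` of the three pieces' kernels are `≤ b₁`, `≤ b₂`, `≤ b₃`, then `Σ_{X∈P} ω X·‖kernel_m (W_{j+1}[K] − W_j[K]) X‖ ≤ b₁ + b₂ + b₃` — with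
`P = {Y : Y 0 = w}`, `ω = klScaleWt L M β (j+1) ((image Y).image gridLegPos)`, `m = 2` this is the slot `b j·U²·β/(2N)` of
`twoLegGridMomentsAt_of_wtIncrements`. -/
theorem sum_wt_norm_kernel_gridEffAction_succ_sub_le {β : ℝ} (hβ : β ≠ 0) (U μ : ℝ) (K : TrigPolyC4v) (j : ℕ)
    (hZ : hubbardEffPartitionFnCT L M β U μ 0 K (klScale klE0 j) ≠ 0) (m : ℕ) (P : Finset (Fin m → GridLeg (GridPoint L (2 * (2 * M)))))
    {ω : (Fin m → GridLeg (GridPoint L (2 * (2 * M)))) → ℝ} (hω : ∀ X ∈ P, 0 ≤ ω X) {b₁ b₂ b₃ : ℝ}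
    (h₁ : ∑ X ∈ P, ω X * ‖kernel ℂ (grassmannLaplacian ℂ
          ((hubbardGridSub L M β (2 * (2 * M))).transpose *
            hubbardCovSliceCT L M β μ 0 K (klScale klE0 (j + 1)) (klScale klE0 j) * hubbardGridSub L M β (2 * (2 * M)))
          (effAction ℂ ((hubbardGridSub L M β (2 * (2 * M))).transpose *
              hubbardCovAboveCT L M β μ 0 K (klScale klE0 j) * hubbardGridSub L M β (2 * (2 * M)))
            (hubbardGridInteraction L (2 * (2 * M)) β U + hubbardGridCounterQuadratic L (2 * (2 * M)) β K))) m X‖ ≤ b₁)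
    (h₂ : ∑ X ∈ P, ω X * ‖kernel ℂ (gaussConv ℂ
            ((hubbardGridSub L M β (2 * (2 * M))).transpose *
              hubbardCovSliceCT L M β μ 0 K (klScale klE0 (j + 1)) (klScale klE0 j) * hubbardGridSub L M β (2 * (2 * M)))
            (effAction ℂ ((hubbardGridSub L M β (2 * (2 * M))).transpose *
                hubbardCovAboveCT L M β μ 0 K (klScale klE0 j) * hubbardGridSub L M β (2 * (2 * M)))
              (hubbardGridInteraction L (2 * (2 * M)) β U + hubbardGridCounterQuadratic L (2 * (2 * M)) β K)) -
          effAction ℂ ((hubbardGridSub L M β (2 * (2 * M))).transpose *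
              hubbardCovAboveCT L M β μ 0 K (klScale klE0 j) * hubbardGridSub L M β (2 * (2 * M)))
            (hubbardGridInteraction L (2 * (2 * M)) β U + hubbardGridCounterQuadratic L (2 * (2 * M)) β K) -
          grassmannLaplacian ℂ
            ((hubbardGridSub L M β (2 * (2 * M))).transpose *
              hubbardCovSliceCT L M β μ 0 K (klScale klE0 (j + 1)) (klScale klE0 j) * hubbardGridSub L M β (2 * (2 * M)))
            (effAction ℂ ((hubbardGridSub L M β (2 * (2 * M))).transpose *
                hubbardCovAboveCT L M β μ 0 K (klScale klE0 j) * hubbardGridSub L M β (2 * (2 * M)))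
              (hubbardGridInteraction L (2 * (2 * M)) β U + hubbardGridCounterQuadratic L (2 * (2 * M)) β K))) m X‖ ≤ b₂)
    (h₃ : ∑ X ∈ P, ω X * ‖kernel ℂ (effAction ℂ
            ((hubbardGridSub L M β (2 * (2 * M))).transpose *
              hubbardCovSliceCT L M β μ 0 K (klScale klE0 (j + 1)) (klScale klE0 j) * hubbardGridSub L M β (2 * (2 * M)))
            (effAction ℂ ((hubbardGridSub L M β (2 * (2 * M))).transpose *
                hubbardCovAboveCT L M β μ 0 K (klScale klE0 j) * hubbardGridSub L M β (2 * (2 * M)))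
              (hubbardGridInteraction L (2 * (2 * M)) β U + hubbardGridCounterQuadratic L (2 * (2 * M)) β K)) -
          gaussConv ℂ
            ((hubbardGridSub L M β (2 * (2 * M))).transpose *
              hubbardCovSliceCT L M β μ 0 K (klScale klE0 (j + 1)) (klScale klE0 j) * hubbardGridSub L M β (2 * (2 * M)))
            (effAction ℂ ((hubbardGridSub L M β (2 * (2 * M))).transpose *
                hubbardCovAboveCT L M β μ 0 K (klScale klE0 j) * hubbardGridSub L M β (2 * (2 * M)))
              (hubbardGridInteraction L (2 * (2 * M)) β U + hubbardGridCounterQuadratic L (2 * (2 * M)) β K))) m X‖ ≤ b₃) :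
    ∑ X ∈ P, ω X * ‖kernel ℂ
        (effAction ℂ ((hubbardGridSub L M β (2 * (2 * M))).transpose *
            hubbardCovAboveCT L M β μ 0 K (klScale klE0 (j + 1)) * hubbardGridSub L M β (2 * (2 * M)))
          (hubbardGridInteraction L (2 * (2 * M)) β U + hubbardGridCounterQuadratic L (2 * (2 * M)) β K) -
        effAction ℂ ((hubbardGridSub L M β (2 * (2 * M))).transpose *
            hubbardCovAboveCT L M β μ 0 K (klScale klE0 j) * hubbardGridSub L M β (2 * (2 * M)))
          (hubbardGridInteraction L (2 * (2 * M)) β U + hubbardGridCounterQuadratic L (2 * (2 * M)) β K)) m X‖ ≤ b₁ + b₂ + b₃ := by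
  refine le_trans (sum_le_sum fun X hX => mul_le_mul_of_nonneg_left (norm_kernel_gridEffAction_succ_sub_le hβ U μ K j hZ m X) (hω X hX)) ?_
  simp only [mul_add, sum_add_distrib]
  exact add_le_add (add_le_add h₁ h₂) h₃

end Model

end Summit.HubbardSuperconductivity.HubbardSuperconductivity.Theorems.EngineV8

end
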